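import Summits.RiemannHypothesis.RiemannHypothesis.Theorems.TiltedLandingLaw421R3SinkTemplate

/-!
# C3 (rh-idea-3 g56) — IMAGE «CornerReduction» v2: the THREE-POINT REDUCTION of RIGHT-SIDED corner dominance (W-08 ⟨33346⟩ `TiltedLandingLaw421R`, regime 3′, sink line)

Files-only (0 kit · 0 registry verbs · 0 proposals); ONE import = the TREE module 102 `RhW08.SinkTemplate` (LAND #1255); own namespace
`RhW08.SinkCornerReduction`; nothing of 102 (or of C1's image 110 «SinkBdry») re-declared.  LEVEL: K (kernel-checked algebra / order on ℝ) — no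
analytic conjecture is proved here; one is RE-TYPED and REDUCED.

v2 (director-rh (CA972)(2), after C1 g39 ALERT-1): 102's unsided `RhW08.SinkTemplate.CornerDominanceSig` is FALSE AS TYPED for children LEFT of the
axis (`w.re < xv`): `realTwoPoint` hard-wires the cut direction `e = −1`, whose mirror image is an `e = +1` family, so for a left child the corner ratios
change sign (C1's decided instance `R = 2, s = 1/3, h = 3/5, y0 = 1, w = xv − 1/10 + (11/20)i`; kernel proof in C1's «SinkMirrorNeg»).  The statement
that the numerics and the exact certificates support is the RIGHT-SIDED one, `CornerDominanceRSig` below := 102's binders + the side condition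
`xv ≤ w.re` (left children are served by the mirror family, C1's drawer «SinkMirror»).  102's `def` is left untouched (a settled negative once
`¬ CornerDominanceSig` lands); here it only appears in the one-line weakening `cornerDominanceRSig_of_sig`.

THE REDUCTION.  For the real-part two-point family `realTwoPoint xv h y0 w` the numerator `N_{y0}(u) = cutNumer (realTwoPoint xv h y0 w) w u` is AFFINE in
the weight `y0` (`= y0·N₁(u) + (1 − y0)·N₀(u)`, §2), hence so are the two top-corner ratios, and `σ*(y0) = cornerSigma … = max (ℓ₊ y0) (ℓ₋ y0)` with
`ℓ±` affine.  For a fixed boundary point `u` the defect `σ*(y0)·c(u) − N_{y0}(u)` is therefore affine on `[0, y×]` and on `[y×, 1]`, where `y×` is the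
(at most one) KINK weight with `ℓ₊(y×) = ℓ₋(y×)` (both corners active); an affine function non-negative at the two ends of an interval is non-negative on
it (§1, the sign of `c(u)` is irrelevant).  CONSEQUENCE (§3): boundary domination (K∂) with `σ = σ*` at `y0 = 0`, at `y0 = 1` and at the kink weight(s)
implies (K∂) with `σ = σ*(y0)` for EVERY `y0 ∈ [0, 1]`; as statements, `CornerDominanceRSig ↔ CornerDominanceEndsRSig ∧ CornerDominanceKinkRSig`.

WHY IT MATTERS (C3 g56 RESULT-1, ideators bus l.3971): the two pure rules `y0 ∈ {0, 1}` bind at ONE corner each and are low-degree one-variable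
polynomial inequalities (even sextic on a column, octic on the lids), but single-corner componentwise dominance is FALSE on the near lid, so the kink
weight `y×` is genuinely a third condition — and it is load-bearing on the (D)-side (rule `{0, 1, y×} ∪ R1`: 0 violations at `R/s ≥ 26`, rule `{0, 1} ∪ R1`:
1–3 per frame).  All three conditions are certified EXACTLY (ℚ-arithmetic + Sturm) at 1 039 rational cone data, frames `R/s ∈ {13, 26, 45, 80, 150}`
(`g56/out/exactgrid-frames.txt`, all with `xv ≤ Re w`); that is evidence, not a proof over the continuum.  The `y0 = 1` half of `CornerDominanceEndsRSig`
is moreover certified over the CONTINUUM by an exact rational branch-and-bound (C3 g56 RESULT-3, `g56/out/k1cert.txt`: every cone datum with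
`xv ≤ Re w`, `Im w ≤ R/3`) — a computer certificate, NOT a Lean proof; the `y0 = 0` half and the kink rule are grid-certified only.

Nothing here bears on the truth of RH; RH is not proved; ⟨33346⟩/⟨33347⟩ OPEN; `CornerDominanceRSig` / `CertificatesExistSig` OPEN.
-/

noncomputable section

open Complex
open scoped ComplexConjugate
open RhW08.SinkTemplate

namespace RhW08.SinkCornerReduction

/-! ## §1 One real variable: an affine function under the maximum of two affine functions — three points suffice -/

/-- interpolation on `[0, y×]`: an affine function of `y` that is `≤ 0` at `y = 0` and at `y = y×` is `≤ 0` in between. -/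
theorem affine_nonpos_left {P Q y yx : ℝ} (hQ : Q ≤ 0) (hx : yx * P + (1 - yx) * Q ≤ 0) (hy0 : 0 ≤ y) (hyx : y ≤ yx) :
    y * P + (1 - y) * Q ≤ 0 := by
  rcases le_or_gt P Q with hPQ | hPQ
  · nlinarith [mul_nonneg hy0 (sub_nonneg.2 hPQ)]
  · nlinarith [mul_le_mul_of_nonneg_right hyx (le_of_lt (sub_pos.2 hPQ))]

/-- interpolation on `[y×, 1]`: an affine function of `y` that is `≤ 0` at `y = y×` and at `y = 1` is `≤ 0` in between. -/
theorem affine_nonpos_right {P Q y yx : ℝ} (hP : P ≤ 0) (hx : yx * P + (1 - yx) * Q ≤ 0) (hyx : yx ≤ y) (hy1 : y ≤ 1) :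
    y * P + (1 - y) * Q ≤ 0 := by
  have h := affine_nonpos_left (P := Q) (Q := P) (y := 1 - y) (yx := 1 - yx) hP (by linarith) (by linarith) (by linarith)
  linarith

/-- THREE-POINT LEMMA.  `ℓ₊(y) = y·Ap + (1 − y)·Bp`, `ℓ₋(y) = y·Am + (1 − y)·Bm`, `N(y) = y·X + (1 − y)·Z` (all affine in `y`), `c` a constant of either sign.
If `N ≤ max(ℓ₊, ℓ₋)·c` holds at `y = 0`, at `y = 1`, and at every `y ∈ (0, 1)` with `ℓ₊(y) = ℓ₋(y)`, then it holds at every `y ∈ [0, 1]`.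
(The hypotheses at `0` and `1` are written un-simplified so that they are literally the `y0 := 0`, `y0 := 1` instances of the conclusion.) -/
theorem affine_le_max_affine_of_three (Ap Bp Am Bm X Z c : ℝ)
    (h0 : 0 * X + (1 - 0) * Z ≤ max (0 * Ap + (1 - 0) * Bp) (0 * Am + (1 - 0) * Bm) * c)
    (h1 : 1 * X + (1 - 1) * Z ≤ max (1 * Ap + (1 - 1) * Bp) (1 * Am + (1 - 1) * Bm) * c)
    (hx : ∀ y : ℝ, 0 < y → y < 1 → y * Ap + (1 - y) * Bp = y * Am + (1 - y) * Bm →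
      y * X + (1 - y) * Z ≤ max (y * Ap + (1 - y) * Bp) (y * Am + (1 - y) * Bm) * c) :
    ∀ y : ℝ, 0 ≤ y → y ≤ 1 → y * X + (1 - y) * Z ≤ max (y * Ap + (1 - y) * Bp) (y * Am + (1 - y) * Bm) * c := by
  simp only [zero_mul, one_mul, sub_zero, sub_self, zero_add, add_zero] at h0 h1
  intro y hy0 hy1
  -- `d(y) = ℓ₊(y) − ℓ₋(y) = (1 − y)·d0 + y·d1`
  have hd : ∀ t : ℝ, (t * Ap + (1 - t) * Bp) - (t * Am + (1 - t) * Bm) = (1 - t) * (Bp - Bm) + t * (Ap - Am) := by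
    intro t; ring
  -- the goal in the form `G ≤ 0` on either branch of the max
  have goal_p : y * Am + (1 - y) * Bm ≤ y * Ap + (1 - y) * Bp → y * (X - Ap * c) + (1 - y) * (Z - Bp * c) ≤ 0 →
      y * X + (1 - y) * Z ≤ max (y * Ap + (1 - y) * Bp) (y * Am + (1 - y) * Bm) * c := by
    intro hle hG
    rw [max_eq_left hle]
    nlinarith [hG]
  have goal_m : y * Ap + (1 - y) * Bp ≤ y * Am + (1 - y) * Bm → y * (X - Am * c) + (1 - y) * (Z - Bm * c) ≤ 0 →
      y * X + (1 - y) * Z ≤ max (y * Ap + (1 - y) * Bp) (y * Am + (1 - y) * Bm) * c := by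
    intro hle hG
    rw [max_eq_right hle]
    nlinarith [hG]
  rcases le_total 0 (Bp - Bm) with hB | hB <;> rcases le_total 0 (Ap - Am) with hA | hA
  · -- `ℓ₊ ≥ ℓ₋` at both ends, hence on `[0, 1]`
    rw [max_eq_left (by linarith : Bm ≤ Bp)] at h0
    rw [max_eq_left (by linarith : Am ≤ Ap)] at h1
    refine goal_p (by nlinarith [mul_nonneg hy0 hA, mul_nonneg (sub_nonneg.2 hy1) hB]) ?_
    nlinarith [mul_nonneg hy0 (by linarith : 0 ≤ Ap * c - X), mul_nonneg (sub_nonneg.2 hy1) (by linarith : 0 ≤ Bp * c - Z)]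
  · -- `ℓ₊ ≥ ℓ₋` at `0`, `ℓ₊ ≤ ℓ₋` at `1`
    rcases eq_or_lt_of_le hB with hB0 | hB0
    · -- `d0 = 0`: then `ℓ₋ ≥ ℓ₊` on `[0, 1]`
      rw [max_eq_right (by linarith : Bp ≤ Bm)] at h0
      rw [max_eq_right (by linarith : Ap ≤ Am)] at h1
      refine goal_m (by nlinarith [mul_nonneg hy0 (by linarith : 0 ≤ Am - Ap)]) ?_
      nlinarith [mul_nonneg hy0 (by linarith : 0 ≤ Am * c - X), mul_nonneg (sub_nonneg.2 hy1) (by linarith : 0 ≤ Bm * c - Z)]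
    rcases eq_or_lt_of_le hA with hA0 | hA0
    · -- `d1 = 0`: then `ℓ₊ ≥ ℓ₋` on `[0, 1]`
      rw [max_eq_left (by linarith : Bm ≤ Bp)] at h0
      rw [max_eq_left (by linarith : Am ≤ Ap)] at h1
      refine goal_p (by nlinarith [mul_nonneg (sub_nonneg.2 hy1) hB]) ?_
      nlinarith [mul_nonneg hy0 (by linarith : 0 ≤ Ap * c - X), mul_nonneg (sub_nonneg.2 hy1) (by linarith : 0 ≤ Bp * c - Z)]
    -- genuine crossing: `d0 > 0 > d1`, kink at `yx = d0 / (d0 − d1) ∈ (0, 1)`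
    rw [max_eq_left (by linarith : Bm ≤ Bp)] at h0
    rw [max_eq_right (by linarith : Ap ≤ Am)] at h1
    have hden : 0 < (Bp - Bm) - (Ap - Am) := by linarith
    set yx := (Bp - Bm) / ((Bp - Bm) - (Ap - Am)) with hyx
    have hyx0 : 0 < yx := div_pos hB0 hden
    have hyx1 : yx < 1 := (div_lt_one hden).2 (by linarith)
    have hkink : yx * Ap + (1 - yx) * Bp = yx * Am + (1 - yx) * Bm := by
      have e : yx * ((Bp - Bm) - (Ap - Am)) = Bp - Bm := div_mul_cancel₀ _ (ne_of_gt hden)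
      nlinarith [e]
    have hX := hx yx hyx0 hyx1 hkink
    rcases le_total y yx with hyl | hyr
    · -- on `[0, yx]`: `ℓ₊ ≥ ℓ₋`
      have hle : y * Am + (1 - y) * Bm ≤ y * Ap + (1 - y) * Bp := by
        have e : y * ((Bp - Bm) - (Ap - Am)) ≤ Bp - Bm := by
          have := mul_le_mul_of_nonneg_right hyl (le_of_lt hden)
          rwa [div_mul_cancel₀ _ (ne_of_gt hden)] at this
        nlinarith [e]
      rw [max_eq_left (le_of_eq hkink.symm)] at hX
      refine goal_p hle (affine_nonpos_left (yx := yx) (by linarith) (by nlinarith [hX]) hy0 hyl)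
    · -- on `[yx, 1]`: `ℓ₊ ≤ ℓ₋`
      have hle : y * Ap + (1 - y) * Bp ≤ y * Am + (1 - y) * Bm := by
        have e : Bp - Bm ≤ y * ((Bp - Bm) - (Ap - Am)) := by
          have := mul_le_mul_of_nonneg_right hyr (le_of_lt hden)
          rwa [div_mul_cancel₀ _ (ne_of_gt hden)] at this
        nlinarith [e]
      rw [max_eq_right (le_of_eq hkink)] at hX
      refine goal_m hle (affine_nonpos_right (yx := yx) (by linarith) (by nlinarith [hX]) hyr hy1)
  · -- `ℓ₊ ≤ ℓ₋` at `0`, `ℓ₊ ≥ ℓ₋` at `1`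
    rcases eq_or_lt_of_le hB with hB0 | hB0
    · -- `d0 = 0`: `ℓ₊ ≥ ℓ₋` on `[0, 1]`
      rw [max_eq_left (by linarith : Bm ≤ Bp)] at h0
      rw [max_eq_left (by linarith : Am ≤ Ap)] at h1
      refine goal_p (by nlinarith [mul_nonneg hy0 hA]) ?_
      nlinarith [mul_nonneg hy0 (by linarith : 0 ≤ Ap * c - X), mul_nonneg (sub_nonneg.2 hy1) (by linarith : 0 ≤ Bp * c - Z)]
    rcases eq_or_lt_of_le hA with hA0 | hA0
    · -- `d1 = 0`: `ℓ₋ ≥ ℓ₊` on `[0, 1]`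
      rw [max_eq_right (by linarith : Bp ≤ Bm)] at h0
      rw [max_eq_right (by linarith : Ap ≤ Am)] at h1
      refine goal_m (by nlinarith [mul_nonneg (sub_nonneg.2 hy1) (by linarith : 0 ≤ Bm - Bp)]) ?_
      nlinarith [mul_nonneg hy0 (by linarith : 0 ≤ Am * c - X), mul_nonneg (sub_nonneg.2 hy1) (by linarith : 0 ≤ Bm * c - Z)]
    -- genuine crossing: `d0 < 0 < d1`, kink at `yx = d0 / (d0 − d1) ∈ (0, 1)`
    rw [max_eq_right (by linarith : Bp ≤ Bm)] at h0
    rw [max_eq_left (by linarith : Am ≤ Ap)] at h1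
    have hden : 0 < (Ap - Am) - (Bp - Bm) := by linarith
    set yx := (Bm - Bp) / ((Ap - Am) - (Bp - Bm)) with hyx
    have hyx0 : 0 < yx := div_pos (by linarith) hden
    have hyx1 : yx < 1 := (div_lt_one hden).2 (by linarith)
    have hkink : yx * Ap + (1 - yx) * Bp = yx * Am + (1 - yx) * Bm := by
      have e : yx * ((Ap - Am) - (Bp - Bm)) = Bm - Bp := div_mul_cancel₀ _ (ne_of_gt hden)
      nlinarith [e]
    have hX := hx yx hyx0 hyx1 hkink
    rcases le_total y yx with hyl | hyr
    · -- on `[0, yx]`: `ℓ₊ ≤ ℓ₋`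
      have hle : y * Ap + (1 - y) * Bp ≤ y * Am + (1 - y) * Bm := by
        have e : y * ((Ap - Am) - (Bp - Bm)) ≤ Bm - Bp := by
          have := mul_le_mul_of_nonneg_right hyl (le_of_lt hden)
          rwa [div_mul_cancel₀ _ (ne_of_gt hden)] at this
        nlinarith [e]
      rw [max_eq_right (le_of_eq hkink)] at hX
      refine goal_m hle (affine_nonpos_left (yx := yx) (by linarith) (by nlinarith [hX]) hy0 hyl)
    · -- on `[yx, 1]`: `ℓ₊ ≥ ℓ₋`
      have hle : y * Am + (1 - y) * Bm ≤ y * Ap + (1 - y) * Bp := by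
        have e : Bm - Bp ≤ y * ((Ap - Am) - (Bp - Bm)) := by
          have := mul_le_mul_of_nonneg_right hyr (le_of_lt hden)
          rwa [div_mul_cancel₀ _ (ne_of_gt hden)] at this
        nlinarith [e]
      rw [max_eq_left (le_of_eq hkink.symm)] at hX
      refine goal_p hle (affine_nonpos_right (yx := yx) (by linarith) (by nlinarith [hX]) hyr hy1)
  · -- `ℓ₊ ≤ ℓ₋` at both ends, hence on `[0, 1]`
    rw [max_eq_right (by linarith : Bp ≤ Bm)] at h0
    rw [max_eq_right (by linarith : Ap ≤ Am)] at h1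
    refine goal_m (by nlinarith [mul_nonneg hy0 (by linarith : 0 ≤ Am - Ap), mul_nonneg (sub_nonneg.2 hy1) (by linarith : 0 ≤ Bm - Bp)]) ?_
    nlinarith [mul_nonneg hy0 (by linarith : 0 ≤ Am * c - X), mul_nonneg (sub_nonneg.2 hy1) (by linarith : 0 ≤ Bm * c - Z)]

/-! ## §2 The two-point family is affine in the weight -/

/-- `N_{y0}(u) = y0·N₁(u) + (1 − y0)·N₀(u)`. -/
theorem cutNumer_realTwoPoint_affine (xv h y0 : ℝ) (w u : ℂ) :
    cutNumer (realTwoPoint xv h y0 w) w u =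
      y0 * cutNumer (realTwoPoint xv h 1 w) w u + (1 - y0) * cutNumer (realTwoPoint xv h 0 w) w u := by
  unfold cutNumer realTwoPoint
  simp only [Fin.sum_univ_two, Matrix.cons_val_zero, Matrix.cons_val_one, Matrix.cons_val_fin_one]
  ring

/-- the corner ratios `N/c` are affine in the weight. -/
theorem cornerRatio_realTwoPoint_affine (xv h y0 : ℝ) (w z : ℂ) :
    cornerRatio (realTwoPoint xv h y0 w) w z =
      y0 * cornerRatio (realTwoPoint xv h 1 w) w z + (1 - y0) * cornerRatio (realTwoPoint xv h 0 w) w z := by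
  unfold cornerRatio
  rw [cutNumer_realTwoPoint_affine xv h y0 w z]
  ring

/-- `σ*(y0) = max (ℓ₊ y0) (ℓ₋ y0)` with `ℓ±` affine: `ℓ±(y0) = y0·A± + (1 − y0)·B±`, `A± = N₁/c`, `B± = N₀/c` at the corners `xv ± R/2 + i·R/2`. -/
theorem cornerSigma_realTwoPoint_eq (xv R h y0 : ℝ) (w : ℂ) :
    cornerSigma xv R (realTwoPoint xv h y0 w) w =
      max (y0 * cornerRatio (realTwoPoint xv h 1 w) w ⟨xv + R / 2, R / 2⟩ + (1 - y0) * cornerRatio (realTwoPoint xv h 0 w) w ⟨xv + R / 2, R / 2⟩)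
        (y0 * cornerRatio (realTwoPoint xv h 1 w) w ⟨xv - R / 2, R / 2⟩ + (1 - y0) * cornerRatio (realTwoPoint xv h 0 w) w ⟨xv - R / 2, R / 2⟩) := by
  unfold cornerSigma
  rw [cornerRatio_realTwoPoint_affine xv h y0 w, cornerRatio_realTwoPoint_affine xv h y0 w]

/-! ## §3 The three-point reduction of (K∂) for `realTwoPoint` at `σ = σ*` -/

/-- the KINK condition at weight `y0`: both top corners are active (`ℓ₊(y0) = ℓ₋(y0)`). -/
def KinkWeight (xv R h y0 : ℝ) (w : ℂ) : Prop :=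
  cornerRatio (realTwoPoint xv h y0 w) w ⟨xv + R / 2, R / 2⟩ = cornerRatio (realTwoPoint xv h y0 w) w ⟨xv - R / 2, R / 2⟩

/-- the kink condition in affine form. -/
theorem kinkWeight_iff (xv R h y0 : ℝ) (w : ℂ) :
    KinkWeight xv R h y0 w ↔
      y0 * cornerRatio (realTwoPoint xv h 1 w) w ⟨xv + R / 2, R / 2⟩ + (1 - y0) * cornerRatio (realTwoPoint xv h 0 w) w ⟨xv + R / 2, R / 2⟩ =
        y0 * cornerRatio (realTwoPoint xv h 1 w) w ⟨xv - R / 2, R / 2⟩ + (1 - y0) * cornerRatio (realTwoPoint xv h 0 w) w ⟨xv - R / 2, R / 2⟩ := by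
  unfold KinkWeight
  rw [cornerRatio_realTwoPoint_affine xv h y0 w, cornerRatio_realTwoPoint_affine xv h y0 w]

/-- THREE-POINT REDUCTION (PROVED): for fixed frame `xv, R`, box top `h` and child `w`, boundary domination of the two-point family with `σ = σ*(y0)`
at `y0 = 0`, at `y0 = 1` and at every kink weight `y0 ∈ (0, 1)` implies it at every `y0 ∈ [0, 1]`. -/
theorem kernelDomBdry_realTwoPoint_of_three (xv R h : ℝ) (w : ℂ)
    (h0 : KernelDomBdry xv R (realTwoPoint xv h 0 w) w (cornerSigma xv R (realTwoPoint xv h 0 w) w))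
    (h1 : KernelDomBdry xv R (realTwoPoint xv h 1 w) w (cornerSigma xv R (realTwoPoint xv h 1 w) w))
    (hx : ∀ y0 : ℝ, 0 < y0 → y0 < 1 → KinkWeight xv R h y0 w →
      KernelDomBdry xv R (realTwoPoint xv h y0 w) w (cornerSigma xv R (realTwoPoint xv h y0 w) w)) :
    ∀ y0 : ℝ, 0 ≤ y0 → y0 ≤ 1 → KernelDomBdry xv R (realTwoPoint xv h y0 w) w (cornerSigma xv R (realTwoPoint xv h y0 w) w) := by
  intro y0 hy0 hy1 u hu
  have e0 := h0 u hu
  have e1 := h1 u hu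
  rw [cutNumer_realTwoPoint_affine xv h 0 w u, cornerSigma_realTwoPoint_eq] at e0
  rw [cutNumer_realTwoPoint_affine xv h 1 w u, cornerSigma_realTwoPoint_eq] at e1
  rw [cutNumer_realTwoPoint_affine xv h y0 w u, cornerSigma_realTwoPoint_eq]
  refine affine_le_max_affine_of_three _ _ _ _ _ _ _ e0 e1 ?_ y0 hy0 hy1
  intro y hy hy' hkink
  have hk : KinkWeight xv R h y w := (kinkWeight_iff xv R h y w).2 hkink
  have e := hx y hy hy' hk u hu
  rw [cutNumer_realTwoPoint_affine xv h y w u, cornerSigma_realTwoPoint_eq] at e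
  exact e

/-- RIGHT-SIDED CORNER DOMINANCE (CONJECTURE; the re-typed form of 102's `CornerDominanceSig`, v2): 102's thirteen binders plus the side
condition `xv ≤ w.re` (the child is on or to the right of the axis — the side on which the `e = −1` real-part cuts of `realTwoPoint` are the correct
reading; left children are the mirror image).  For such data the two-point family with `σ = σ* = cornerSigma …` dominates on the boundary of the maximal
strip.  Evidence: exact ℚ+Sturm certification at 1 039 rational cone data (0 failures) and, for `y0 = 1`, an exact branch-and-bound over the continuum. -/
def CornerDominanceRSig : Prop :=
  ∀ (xv R s h y0 : ℝ) (v w : ℂ),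
    0 < s → 6 * s ≤ R → 3 * h < R → v.re = xv → 0 < v.im → v.im ≤ h →
    0 < w.im → w.im < v.im → v.im - s / 4 < w.im → (w.re - xv) ^ 2 + w.im ^ 2 ≤ v.im ^ 2 →
    ConeChild xv R w → xv ≤ w.re → 0 ≤ y0 → y0 ≤ 1 →
    KernelDomBdry xv R (realTwoPoint xv h y0 w) w (cornerSigma xv R (realTwoPoint xv h y0 w) w)

/-- the unsided tree statement implies the right-sided one (one line; recorded only to fix the relation — 102's `CornerDominanceSig` itself is false
for left children, C1 «SinkMirrorNeg»). -/
theorem cornerDominanceRSig_of_sig (hC : CornerDominanceSig) : CornerDominanceRSig :=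
  fun xv R s h y0 v w hs hR6 h3 hv hY hYh ht htY hdrop hnest hcone _ hy0 hy1 =>
    hC xv R s h y0 v w hs hR6 h3 hv hY hYh ht htY hdrop hnest hcone hy0 hy1

/-- RIGHT-SIDED CORNER DOMINANCE AT THE TWO PURE RULES `y0 = 0` and `y0 = 1` (CONJECTURE — `CornerDominanceRSig` restricted to `y0 ∈ {0, 1}`; each
is ONE corner ratio against four one-variable rational inequalities: `y0 = 1` reads only `(R, Re w − xv, Im w)` (it is `h`-free), `y0 = 0` reads
`(R, Re w − xv, Im w, h)`; EXACTLY certified (ℚ + Sturm) at 1 039 rational cone data, frames `R/s ∈ {13, 26, 45, 80, 150}`, 0 failures; the `y0 = 1`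
conjunct is certified over the continuum (exact branch-and-bound, C3 g56 RESULT-3) — not a Lean proof). -/
def CornerDominanceEndsRSig : Prop :=
  ∀ (xv R s h : ℝ) (v w : ℂ),
    0 < s → 6 * s ≤ R → 3 * h < R → v.re = xv → 0 < v.im → v.im ≤ h →
    0 < w.im → w.im < v.im → v.im - s / 4 < w.im → (w.re - xv) ^ 2 + w.im ^ 2 ≤ v.im ^ 2 →
    ConeChild xv R w → xv ≤ w.re →
    KernelDomBdry xv R (realTwoPoint xv h 0 w) w (cornerSigma xv R (realTwoPoint xv h 0 w) w) ∧
    KernelDomBdry xv R (realTwoPoint xv h 1 w) w (cornerSigma xv R (realTwoPoint xv h 1 w) w)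

/-- RIGHT-SIDED CORNER DOMINANCE AT THE KINK WEIGHT (CONJECTURE — `CornerDominanceRSig` restricted to the weights `y0 ∈ (0, 1)` at which both top
corners are active; at most one per datum unless the two corner ratio lines coincide; EXACTLY certified at the 933 of the 1 039 grid data that have a
kink, 0 failures). -/
def CornerDominanceKinkRSig : Prop :=
  ∀ (xv R s h y0 : ℝ) (v w : ℂ),
    0 < s → 6 * s ≤ R → 3 * h < R → v.re = xv → 0 < v.im → v.im ≤ h →
    0 < w.im → w.im < v.im → v.im - s / 4 < w.im → (w.re - xv) ^ 2 + w.im ^ 2 ≤ v.im ^ 2 →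
    ConeChild xv R w → xv ≤ w.re → 0 < y0 → y0 < 1 → KinkWeight xv R h y0 w →
    KernelDomBdry xv R (realTwoPoint xv h y0 w) w (cornerSigma xv R (realTwoPoint xv h y0 w) w)

/-- K-LINK (PROVED): the two restricted conjectures give right-sided corner dominance for every weight `y0 ∈ [0, 1]`. -/
theorem cornerDominanceRSig_of_ends_of_kink (hE : CornerDominanceEndsRSig) (hK : CornerDominanceKinkRSig) : CornerDominanceRSig := by
  intro xv R s h y0 v w hs hR6 h3 hv hY hYh ht htY hdrop hnest hcone hside hy0 hy1
  obtain ⟨h0, h1⟩ := hE xv R s h v w hs hR6 h3 hv hY hYh ht htY hdrop hnest hcone hside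
  exact kernelDomBdry_realTwoPoint_of_three xv R h w h0 h1
    (fun y hy hy' hk => hK xv R s h y v w hs hR6 h3 hv hY hYh ht htY hdrop hnest hcone hside hy hy' hk) y0 hy0 hy1

/-- … and conversely (trivially), so the reduction loses nothing. -/
theorem cornerDominanceRSig_iff_ends_and_kink : CornerDominanceRSig ↔ CornerDominanceEndsRSig ∧ CornerDominanceKinkRSig := by
  constructor
  · intro hC
    refine ⟨fun xv R s h v w hs hR6 h3 hv hY hYh ht htY hdrop hnest hcone hside => ⟨?_, ?_⟩,
      fun xv R s h y0 v w hs hR6 h3 hv hY hYh ht htY hdrop hnest hcone hside hy0 hy1 _ => ?_⟩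
    · exact hC xv R s h 0 v w hs hR6 h3 hv hY hYh ht htY hdrop hnest hcone hside le_rfl zero_le_one
    · exact hC xv R s h 1 v w hs hR6 h3 hv hY hYh ht htY hdrop hnest hcone hside zero_le_one le_rfl
    · exact hC xv R s h y0 v w hs hR6 h3 hv hY hYh ht htY hdrop hnest hcone hside hy0.le hy1.le
  · rintro ⟨hE, hK⟩
    exact cornerDominanceRSig_of_ends_of_kink hE hK

end RhW08.SinkCornerReduction

end
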